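import Summits.QuantumFields.YangMills.Theorems.PoincareLipschitzTowerReadingSets
import HarnessLib

/-!
# Crux `HistoryTailL` (stmt-QuantumFields-19936), K2 face v2 `hRegH` (route crux `PoincareLipschitz.BlockLipschitzL`, stmt-QuantumFields-23533):
# PREFIX LETTERS — the crux WINDOW makes every K1 box with ROOM plaquette-small, and such boxes do not wrap

Cell `ym3-torus` (YM ladder rung R3 = continuum SU(2) Yang–Mills on T³ — a RUNG, NOT the Clay problem); width seat `ym-ust-19936-w2` g11, F6 pen (LEAD
`ym-ust-19936-w1` g8 05:29:02Z (3): «the final `hRegH_of_hImprove` = w2's prefix letters»).  Helper `--supports stmt-QuantumFields-19936`; THEOREMS ONLY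
(0 `def`, 0 `sorry`), T3 letters.

WHAT IT DOES.  The stability knit ✓`PoincareLipschitzOrbitMinBoxEnergy.orbitMin_plateau_energy_le` ([A]) wants, on a K1 box `{y : (y_k − x₀_k).val < n ∀k}` at
level `i`, (α) plaquette smallness of BOTH fields on the box and (β) `2n ≤ sitesPerDir i`.  At `hRegH`'s prefix these come from the crux WINDOW (`winU`,
VERBATIM from hStab⋆: `D_i(q) + 64Lⁱ ≤ 64L^{j+1} ⇒ dist1((ŪⁱU)(∂q)) < θ(K−i)`) and the ROOM clause `D_i(b) + R·Lⁱ + 2L^{i+1} + M ≤ 8L^{j+1}` of a bond `b` of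
the box, once `3n ≤ R`: two sites of one K1 box are within `3(n−1)` at level `i` (§1 `tdist_le_of_box`), scaled corners stretch level-`i` distances by at most
`Lⁱ` (§2 `tdist_corner_le_mul`), so `D_i(q) ≤ D_i(b) + 3(n−1)Lⁱ ≤ 8L^{j+1} − 2L^{i+1}` and ✓`window_of_readingSet` gives the window (§3); and
`3n·Lⁱ ≤ R·Lⁱ ≤ 8L^{j+1} ≤ L^{m+K}` gives `n ≤ L^{m+K−i} = sitesPerDir i ∕ 2` (§3, `K ≥ j + 3`, `m ≥ 1`).

WHAT IS PROVED (ns `…Theorems.PoincareLipschitzOrbitMinBoxWindow`).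
* §1 `min_val_sub_le_of_lt` (two offsets `< n` differ by `≤ n − 1` circularly), `tdist_le_of_box` (`tdist y y′ ≤ d(n−1)` inside one K1 box).
* §2 `corner_sub_eq` (`corner y − corner y′ = (y − y′).val·Lⁱ` in `ZMod N₀`), ★`tdist_corner_le_mul` (`tdist(corner y, corner y′) ≤ Lⁱ·tdist(y, y′)`).
* §3 ★★ `plaqSmall_box_of_window` ((α) for one field; apply twice), ★ `two_mul_le_sitesPerDir_of_room` ((β)),
  ★ `mem_readingSet_of_box` (v1.1: the box lies in `S_i^M` — the `hS` input of the flat shadow).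
HONEST SCOPE.  Torus bookkeeping only; nothing of `hRegH` ∕ `hImprove` ∕ 23533 ∕ 19936 is proved.  YM₃ on T³ is rung R3, not Clay; YM gap NOT proved.

References: T. Bałaban, CMP 109 (1987) 249–301 [Balaban1987RG1] ((0.1)–(0.4) pp.251–253: the tori `T^{(j)}` and their embeddings).
-/

set_option autoImplicit false

noncomputable section

open scoped BigOperators

namespace Summit.QuantumFields.YangMills.Theorems.PoincareLipschitzOrbitMinBoxWindow

open Literature.MathematicalPhysics.QuantumFieldTheory.Balaban1983to89
open Literature.MathematicalPhysics.QuantumFieldTheory.Balaban1983to89.T3ContinuumYM3Torus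
open Summit.QuantumFields.YangMills.Theorems.PoincareLipschitzIteratedOfAvgStability (sitesPerDir_zero_eq_mul_pow)
open Summit.QuantumFields.YangMills.Theorems.PoincareLipschitzTowerReadingSets (window_of_readingSet tdist_comm)
open B3Taylor310LocalRemainder (tdist_triangle)

/-! ## §1 Two sites of one K1 box -/

/-- Two residues with offsets `< n` from a common origin differ by `≤ n − 1`, circularly. [folklore] -/
theorem min_val_sub_le_of_lt {N n : ℕ} [NeZero N] (o o' : ZMod N) (ho : o.val < n) (ho' : o'.val < n) :
    min (o - o').val (o' - o).val ≤ n - 1 := by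
  rcases le_total o'.val o.val with h | h
  · refine (min_le_left _ _).trans ?_
    rw [ZMod.val_sub h]; omega
  · refine (min_le_right _ _).trans ?_
    rw [ZMod.val_sub h]; omega

/-- **INSIDE ONE K1 BOX** two sites are within `d·(n − 1)` in the `ℓ¹` torus distance. [folklore] -/
theorem tdist_le_of_box {P : Params} {i : ℕ} (x₀ y y' : Site P i) {n : ℕ} (hy : ∀ k, (y k - x₀ k).val < n) (hy' : ∀ k, (y' k - x₀ k).val < n) :
    Site.tdist y y' ≤ P.d * (n - 1) := by
  unfold Site.tdist
  calc ∑ μ : Fin P.d, min (y μ - y' μ).val (y' μ - y μ).val ≤ ∑ _μ : Fin P.d, (n - 1) := by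
        refine Finset.sum_le_sum fun μ _ => ?_
        have e1 : y μ - y' μ = (y μ - x₀ μ) - (y' μ - x₀ μ) := by ring
        have e2 : y' μ - y μ = (y' μ - x₀ μ) - (y μ - x₀ μ) := by ring
        rw [e1, e2]
        exact min_val_sub_le_of_lt _ _ (hy μ) (hy' μ)
    _ = P.d * (n - 1) := by rw [Finset.sum_const, Finset.card_univ, Fintype.card_fin, smul_eq_mul]

/-! ## §2 Scaled corners stretch level-`i` distances by at most `Lⁱ` -/

section Corners

variable (F : T3Family) (K : ℕ)

/-- `corner_i y − corner_i y′ = ((y − y′).val·Lⁱ : ZMod N₀)` (`N₀ = N_i·Lⁱ`, so the reduction mod `N_i` is invisible after scaling). [folklore] -/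
theorem corner_sub_eq {i : ℕ} (hi : i ≤ F.m + K) (y y' : Site (F.P K) i) (k : Fin (F.P K).d) :
    ((((y k).val * F.L ^ i : ℕ)) : ZMod ((F.P K).sitesPerDir 0)) - ((((y' k).val * F.L ^ i : ℕ)) : ZMod ((F.P K).sitesPerDir 0)) =
      (((((y k - y' k).val * F.L ^ i : ℕ)) : ZMod ((F.P K).sitesPerDir 0))) := by
  set Ni := (F.P K).sitesPerDir i with hNi
  have hN0 : (F.P K).sitesPerDir 0 = Ni * F.L ^ i := sitesPerDir_zero_eq_mul_pow F K hi
  have hyk : y k = y' k + (y k - y' k) := by ring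
  have hval : (y k).val = ((y' k).val + (y k - y' k).val) % Ni := by
    conv_lhs => rw [hyk]
    rw [ZMod.val_add]
  have h0 : (((Ni * F.L ^ i : ℕ)) : ZMod ((F.P K).sitesPerDir 0)) = 0 := by rw [← hN0]; exact ZMod.natCast_self _
  set v := (y' k).val with hv
  set t := (y k - y' k).val with ht
  have hdm : v + t = Ni * ((v + t) / Ni) + (v + t) % Ni := (Nat.div_add_mod _ _).symm
  have e : (((((v + t) % Ni) * F.L ^ i : ℕ)) : ZMod ((F.P K).sitesPerDir 0)) = ((((v + t) * F.L ^ i : ℕ)) : ZMod ((F.P K).sitesPerDir 0)) := by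
    conv_rhs => rw [hdm]
    have : (Ni * ((v + t) / Ni) + (v + t) % Ni) * F.L ^ i = (Ni * F.L ^ i) * ((v + t) / Ni) + ((v + t) % Ni) * F.L ^ i := by ring
    rw [this]; push_cast
    rw [show (((Ni : ℕ)) : ZMod ((F.P K).sitesPerDir 0)) * (((F.L : ℕ)) : ZMod _) ^ i = (((Ni * F.L ^ i : ℕ)) : ZMod _) by push_cast; ring, h0]
    ring
  rw [hval, e]; push_cast; ring

/-- ★ **SCALED CORNERS STRETCH BY AT MOST `Lⁱ`**: `tdist(corner_i y, corner_i y′) ≤ Lⁱ · tdist(y, y′)`. [folklore] -/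
theorem tdist_corner_le_mul {i : ℕ} (hi : i ≤ F.m + K) (y y' : Site (F.P K) i) :
    Site.tdist (fun k => ((((y k).val * F.L ^ i : ℕ)) : ZMod ((F.P K).sitesPerDir 0)))
        (fun k => ((((y' k).val * F.L ^ i : ℕ)) : ZMod ((F.P K).sitesPerDir 0))) ≤ F.L ^ i * Site.tdist y y' := by
  unfold Site.tdist
  rw [Finset.mul_sum]
  refine Finset.sum_le_sum fun k _ => ?_
  have h1 : ((((( y k).val * F.L ^ i : ℕ)) : ZMod ((F.P K).sitesPerDir 0)) - ((((y' k).val * F.L ^ i : ℕ)) : ZMod ((F.P K).sitesPerDir 0))).val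
      ≤ (y k - y' k).val * F.L ^ i := by
    rw [corner_sub_eq F K hi y y' k, ZMod.val_natCast]; exact Nat.mod_le _ _
  have h2 : ((((( y' k).val * F.L ^ i : ℕ)) : ZMod ((F.P K).sitesPerDir 0)) - ((((y k).val * F.L ^ i : ℕ)) : ZMod ((F.P K).sitesPerDir 0))).val
      ≤ (y' k - y k).val * F.L ^ i := by
    rw [corner_sub_eq F K hi y' y k, ZMod.val_natCast]; exact Nat.mod_le _ _
  rcases le_total (y k - y' k).val (y' k - y k).val with h | h
  · rw [min_eq_left h]; refine (min_le_left _ _).trans ?_; rw [mul_comm]; exact h1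
  · rw [min_eq_right h]; refine (min_le_right _ _).trans ?_; rw [mul_comm]; exact h2

end Corners

/-! ## §3 The window on a K1 box with room, and the box does not wrap -/

/-- ★★ **WINDOW ⟹ PLAQUETTE SMALLNESS ON A K1 BOX WITH ROOM**: if the crux window holds for `U` (hStab⋆'s `winU`, VERBATIM), `i < j`, and a bond `b` of the
K1 box of side `n` cornered at `x₀` has ROOM `D_i(b) + R·Lⁱ + 2L^{i+1} + M ≤ 8L^{j+1}` with `3n ≤ R`, then every level-`i` plaquette based in the box has
`dist1((ŪⁱU)(∂q)) < θ(K−i)` (= the `hV`∕`hW` input of ✓`orbitMin_plateau_energy_le`). [cite: Balaban1987RG1, (0.4) p.253] -/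
theorem plaqSmall_box_of_window (F : T3Family) {γ b₀ p₀ : ℝ} {K j i : ℕ} (hi : i < j) (hjK : j + 3 ≤ K)
    (a : Plaq (F.P K) (j + 1)) (U : GaugeField (F.P K) 0 (Matrix.specialUnitaryGroup (Fin 2) ℂ))
    (hwU : ∀ (i : ℕ) (q : Plaq (F.P K) i), i < j + 1 → Site.tdist (fun k => ((((q.src k).val * F.L ^ i : ℕ)) : ZMod ((F.P K).sitesPerDir 0))) (fun k => ((((a.src k).val * F.L ^ (j + 1) : ℕ)) : ZMod ((F.P K).sitesPerDir 0))) + 64 * F.L ^ i ≤ 64 * F.L ^ (j + 1) → GaugeGroup.dist1 (GaugeField.plaqHol (Averaging.iter (fun i' => BlockAveraging.blockAvg (P := F.P K) (j := i') T3UnitLawDensityEML.ℰp) i U) q) < T3UnitScaleTilt.θBal F.L γ b₀ p₀ (K - i))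
    (x₀ : Site (F.P K) i) {n : ℕ} (b : PBond (F.P K) i) (hb : ∀ k, (b.src k - x₀ k).val < n)
    (M : ℕ) {R : ℝ} (hroom : ((Site.tdist (fun k => ((((b.src k).val * F.L ^ i : ℕ)) : ZMod ((F.P K).sitesPerDir 0))) (fun k => ((((a.src k).val * F.L ^ (j + 1) : ℕ)) : ZMod ((F.P K).sitesPerDir 0))) : ℕ) : ℝ) + R * (F.L : ℝ) ^ i + 2 * (F.L : ℝ) ^ (i + 1) + (M : ℝ) ≤ 8 * (F.L : ℝ) ^ (j + 1))
    (hn : 3 * (n : ℝ) ≤ R) (q : Plaq (F.P K) i) (hq : ∀ k, (q.src k - x₀ k).val < n) :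
    GaugeGroup.dist1 (GaugeField.plaqHol (Averaging.iter (fun i' => BlockAveraging.blockAvg (P := F.P K) (j := i') T3UnitLawDensityEML.ℰp) i U) q) <
      T3UnitScaleTilt.θBal F.L γ b₀ p₀ (K - i) := by
  have hd : (F.P K).d = 3 := rfl
  have hiK : i ≤ F.m + K := by omega
  refine hwU i q (by omega) (window_of_readingSet F K hi.le a.src q.src ?_)
  -- `D_i(q) ≤ D_i(b) + Lⁱ·tdist(q₋, b₋) ≤ D_i(b) + 3(n−1)Lⁱ`
  have h1 := tdist_triangle (fun k => ((((q.src k).val * F.L ^ i : ℕ)) : ZMod ((F.P K).sitesPerDir 0)))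
    (fun k => ((((b.src k).val * F.L ^ i : ℕ)) : ZMod ((F.P K).sitesPerDir 0)))
    (fun k => ((((a.src k).val * F.L ^ (j + 1) : ℕ)) : ZMod ((F.P K).sitesPerDir 0)))
  have h2 := tdist_corner_le_mul F K hiK q.src b.src
  have h3 : Site.tdist q.src b.src ≤ 3 * (n - 1) := by have := tdist_le_of_box x₀ q.src b.src hq hb; rwa [hd] at this
  have h4 : F.L ^ i * Site.tdist q.src b.src ≤ F.L ^ i * (3 * (n - 1)) := Nat.mul_le_mul_left _ h3
  -- the room, in `ℕ`
  have hn1 : 1 ≤ n := by have := hb ⟨0, by rw [hd]; omega⟩; omega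
  have hroomN : (Site.tdist (fun k => ((((b.src k).val * F.L ^ i : ℕ)) : ZMod ((F.P K).sitesPerDir 0))) (fun k => ((((a.src k).val * F.L ^ (j + 1) : ℕ)) : ZMod ((F.P K).sitesPerDir 0)))) + 3 * (n - 1) * F.L ^ i + 2 * F.L ^ (i + 1) ≤ 8 * F.L ^ (j + 1) := by
    have hLi : (0 : ℝ) ≤ (F.L : ℝ) ^ i := by positivity
    have hM0 : (0 : ℝ) ≤ (M : ℝ) := Nat.cast_nonneg _
    have h3n : (3 * (n - 1 : ℕ) : ℝ) * (F.L : ℝ) ^ i ≤ R * (F.L : ℝ) ^ i := by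
      refine mul_le_mul_of_nonneg_right ?_ hLi
      have : ((n - 1 : ℕ) : ℝ) ≤ n := by exact_mod_cast Nat.sub_le n 1
      linarith
    have key : ((Site.tdist (fun k => ((((b.src k).val * F.L ^ i : ℕ)) : ZMod ((F.P K).sitesPerDir 0))) (fun k => ((((a.src k).val * F.L ^ (j + 1) : ℕ)) : ZMod ((F.P K).sitesPerDir 0))) : ℕ) : ℝ) + (3 * (n - 1 : ℕ) : ℝ) * (F.L : ℝ) ^ i + 2 * (F.L : ℝ) ^ (i + 1) ≤ 8 * (F.L : ℝ) ^ (j + 1) := by linarith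
    exact_mod_cast key
  have h5 : F.L ^ i * (3 * (n - 1)) = 3 * (n - 1) * F.L ^ i := by ring
  omega

/-- ★ **THE BOX DOES NOT WRAP**: with the same room and `3n ≤ R`, `2n ≤ sitesPerDir i` (`3nLⁱ ≤ 8L^{j+1} ≤ L^{m+K}`, `K ≥ j + 3`, `m ≥ 1`; `sitesPerDir i = 2L^{m+K−i}`).
[cite: Balaban1987RG1, (0.1) p.251] -/
theorem two_mul_le_sitesPerDir_of_room (F : T3Family) {K j i : ℕ} (hi : i < j) (hjK : j + 3 ≤ K)
    (a : Plaq (F.P K) (j + 1)) (b : PBond (F.P K) i) (M : ℕ) {R : ℝ} {n : ℕ}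
    (hroom : ((Site.tdist (fun k => ((((b.src k).val * F.L ^ i : ℕ)) : ZMod ((F.P K).sitesPerDir 0))) (fun k => ((((a.src k).val * F.L ^ (j + 1) : ℕ)) : ZMod ((F.P K).sitesPerDir 0))) : ℕ) : ℝ) + R * (F.L : ℝ) ^ i + 2 * (F.L : ℝ) ^ (i + 1) + (M : ℝ) ≤ 8 * (F.L : ℝ) ^ (j + 1))
    (hn : 3 * (n : ℝ) ≤ R) : 2 * n ≤ (F.P K).sitesPerDir i := by
  have hL3 : 3 ≤ F.L := (by obtain ⟨k, hk⟩ := F.hL.1; have := F.hL.2; omega)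
  have hm : 1 ≤ F.m := F.hm
  have hNi : (F.P K).sitesPerDir i = 2 * F.L ^ (F.m + K - i) := rfl
  -- `3·n·Lⁱ ≤ 8·L^{j+1}` in `ℕ`
  have h1 : 3 * n * F.L ^ i ≤ 8 * F.L ^ (j + 1) := by
    have hLi : (0 : ℝ) ≤ (F.L : ℝ) ^ i := by positivity
    have hM0 : (0 : ℝ) ≤ (M : ℝ) := Nat.cast_nonneg _
    have hD0 : (0 : ℝ) ≤ ((Site.tdist (fun k => ((((b.src k).val * F.L ^ i : ℕ)) : ZMod ((F.P K).sitesPerDir 0))) (fun k => ((((a.src k).val * F.L ^ (j + 1) : ℕ)) : ZMod ((F.P K).sitesPerDir 0))) : ℕ) : ℝ) := Nat.cast_nonneg _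
    have hLi1 : (0 : ℝ) ≤ (F.L : ℝ) ^ (i + 1) := by positivity
    have key : (3 * n : ℝ) * (F.L : ℝ) ^ i ≤ 8 * (F.L : ℝ) ^ (j + 1) := by linarith [mul_le_mul_of_nonneg_right hn hLi]
    exact_mod_cast key
  -- `8·L^{j+1} ≤ L^{j+3}·… ≤ L^{m+K}` and `L^{m+K} = L^{m+K−i}·Lⁱ`
  have h2 : 8 * F.L ^ (j + 1) ≤ F.L ^ (F.m + K - i) * F.L ^ i := by
    rw [← pow_add, show F.m + K - i + i = F.m + K by omega]
    calc 8 * F.L ^ (j + 1) ≤ F.L ^ 2 * F.L ^ (j + 1) := Nat.mul_le_mul_right _ (by nlinarith)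
      _ = F.L ^ (j + 3) := by rw [← pow_add]; ring_nf
      _ ≤ F.L ^ (F.m + K) := Nat.pow_le_pow_right (by omega) (by omega)
  have h3 : 3 * n * F.L ^ i ≤ F.L ^ (F.m + K - i) * F.L ^ i := h1.trans h2
  have h4 : 3 * n ≤ F.L ^ (F.m + K - i) := Nat.le_of_mul_le_mul_right h3 (pow_pos (by omega) _)
  rw [hNi]; omega

/-- ★ **A K1 BOX WITH ROOM LIES IN THE READING SET** (v1.1 append): with the same room and `3n ≤ R`, every site `y` of the box satisfies the membership
inequality of `S_i^M = {D_i + 2L^{i+1} + M ≤ 8L^{j+1}}` — so all bonds based in the box belong to `S_i^M` (the `hS` input of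
✓`PoincareLipschitzOrbitMinFlatShadow.exists_flatShadow`∕`localMin_of_dictionary`). [cite: Balaban1987RG1, (0.4) p.253] -/
theorem mem_readingSet_of_box (F : T3Family) {K j i : ℕ} (hi : i < j) (hjK : j + 3 ≤ K)
    (a : Plaq (F.P K) (j + 1)) (x₀ : Site (F.P K) i) {n : ℕ} (b : PBond (F.P K) i) (hb : ∀ k, (b.src k - x₀ k).val < n)
    (M : ℕ) {R : ℝ} (hroom : ((Site.tdist (fun k => ((((b.src k).val * F.L ^ i : ℕ)) : ZMod ((F.P K).sitesPerDir 0))) (fun k => ((((a.src k).val * F.L ^ (j + 1) : ℕ)) : ZMod ((F.P K).sitesPerDir 0))) : ℕ) : ℝ) + R * (F.L : ℝ) ^ i + 2 * (F.L : ℝ) ^ (i + 1) + (M : ℝ) ≤ 8 * (F.L : ℝ) ^ (j + 1))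
    (hn : 3 * (n : ℝ) ≤ R) (y : Site (F.P K) i) (hy : ∀ k, (y k - x₀ k).val < n) :
    Site.tdist (fun k => ((((y k).val * F.L ^ i : ℕ)) : ZMod ((F.P K).sitesPerDir 0))) (fun k => ((((a.src k).val * F.L ^ (j + 1) : ℕ)) : ZMod ((F.P K).sitesPerDir 0))) + 2 * F.L ^ (i + 1) + M ≤ 8 * F.L ^ (j + 1) := by
  have hd : (F.P K).d = 3 := rfl
  have hiK : i ≤ F.m + K := by omega
  have h1 := tdist_triangle (fun k => ((((y k).val * F.L ^ i : ℕ)) : ZMod ((F.P K).sitesPerDir 0)))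
    (fun k => ((((b.src k).val * F.L ^ i : ℕ)) : ZMod ((F.P K).sitesPerDir 0)))
    (fun k => ((((a.src k).val * F.L ^ (j + 1) : ℕ)) : ZMod ((F.P K).sitesPerDir 0)))
  have h2 := tdist_corner_le_mul F K hiK y b.src
  have h3 : Site.tdist y b.src ≤ 3 * (n - 1) := by have := tdist_le_of_box x₀ y b.src hy hb; rwa [hd] at this
  have h4 : F.L ^ i * Site.tdist y b.src ≤ F.L ^ i * (3 * (n - 1)) := Nat.mul_le_mul_left _ h3
  have hroomN : (Site.tdist (fun k => ((((b.src k).val * F.L ^ i : ℕ)) : ZMod ((F.P K).sitesPerDir 0))) (fun k => ((((a.src k).val * F.L ^ (j + 1) : ℕ)) : ZMod ((F.P K).sitesPerDir 0)))) + 3 * (n - 1) * F.L ^ i + 2 * F.L ^ (i + 1) + M ≤ 8 * F.L ^ (j + 1) := by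
    have hLi : (0 : ℝ) ≤ (F.L : ℝ) ^ i := by positivity
    have h3n : (3 * (n - 1 : ℕ) : ℝ) * (F.L : ℝ) ^ i ≤ R * (F.L : ℝ) ^ i := by
      refine mul_le_mul_of_nonneg_right ?_ hLi
      have : ((n - 1 : ℕ) : ℝ) ≤ n := by exact_mod_cast Nat.sub_le n 1
      linarith
    have key : ((Site.tdist (fun k => ((((b.src k).val * F.L ^ i : ℕ)) : ZMod ((F.P K).sitesPerDir 0))) (fun k => ((((a.src k).val * F.L ^ (j + 1) : ℕ)) : ZMod ((F.P K).sitesPerDir 0))) : ℕ) : ℝ) + (3 * (n - 1 : ℕ) : ℝ) * (F.L : ℝ) ^ i + 2 * (F.L : ℝ) ^ (i + 1) + (M : ℝ) ≤ 8 * (F.L : ℝ) ^ (j + 1) := by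
      linarith
    exact_mod_cast key
  have h5 : F.L ^ i * (3 * (n - 1)) = 3 * (n - 1) * F.L ^ i := by ring
  omega

end Summit.QuantumFields.YangMills.Theorems.PoincareLipschitzOrbitMinBoxWindow

end
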